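import Summits.CriticalPhenomena.PercolationContinuityZ3.Theorems.PercNearOneGluingNoHeavyLowerTailKnQuestion8AntitheticCrownBridge
import HarnessLib

/-!
# `NoHeavyLowerTail` (crux stmt-CriticalPhenomena-4575), antithetic vdBHK programme: the INFLATION LEMMA — the induction step of THEOREM C∞
# ('the colouring poset of the crown cycle C_2k is not antipodal Kleitman for every k ≥ 3'), in abstract (hypothesis-style) form

Support file (seat `prim-ineq-gen-7` gen 47; `--supports stmt-CriticalPhenomena-4575`).  No `sorry`, no definitions.
Memo / pencil proof: run/shared/lean/prim/prim-ineq-gen-7/PROOF-INFLATION-g47.md, FINDING-CYCLES-g47.md §3.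

THE LEMMA.  Subdivide an atom `a` of a finite poset whose only upper covers are two maximal elements `u` (over `a` and one further atom `p_u`) and `w`
(over `a` and `p_w`) into a block `a < y > a'` (`y` a new maximal element, `u > a`, `w > a'`).  Colourings of the old poset are pairs (rest `σ`, colour
of `a`); colourings of the new poset are pairs (rest `σ`, colours of `a, y, a'`); both colouring posets carry the labelwise Λ-order
(`Λ = {RI=0, BN=2} < {RN=1, BI=3}`, relation `leL` of `AntitheticCrownUniversal`), written out coordinatewise in the hypotheses `hle1`, `hle2` (the
rest coordinates contribute an arbitrary transitive relation `restle` along which the atoms `p_u, p_w` can only turn blue).  Then for ALL up-sets `A', B'`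
of the old colouring poset the sets
  `A = {y = RN} ∪ {y = RI, σ^r ∈ A'} ∪ {y = BI, σ^b ∈ A'}`,   `B = {y = RI, σ^r ∈ B'} ∪ {y = BI, σ^b ∈ B'} ∪ {y ∈ {RN, BN}, σ ∈ Cl(B'_r)}`,
`Cl(B'_r) = {σ' : ∃ σ, σ^r ∈ B', σ^r ≤ σ'^b}`, are up-sets of the new colouring poset with the SAME antipodal defect `#(A ∩ B) − #(A ∩ ιB)`, and `A` is a
half if `A'` is.  Key step: the cross relation `σ ◁ σ' :⟺ σ^r ≤ σ'^b` is transitive (`cross_trans_core`, a 64-case Boolean fact, plus monotonicity of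
`p_u, p_w`).  Starting from the crown (defect −1, `AntitheticCrownCertificate`) and inflating k−3 times gives THEOREM C∞: Ω(C_2k) is not AK for every
k ≥ 3 (machine-verified exactly for k ≤ 7; the cycle instantiation in Lean is left to a later file).
* `AntitheticInflation.cross_trans_core`, `lab_atom_mono`, `block_facts` — finite Λ-facts by `decide`;
* `AntitheticInflation.inflation` — the lemma.
-/

namespace Summit.CriticalPhenomena.PercolationContinuityZ3.Theorems

open Finset

namespace AntitheticInflation

/-- Finite Boolean core of the transitivity of the cross relation (PROOF-INFLATION-g47 §1, Lemma 1): the `u`-coordinate. [this work] -/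
theorem cross_trans_core
    (leL : ℕ → ℕ → Bool)
    (hleL : leL = fun p q => p == q || (p == 0 && q == 1) || (p == 0 && q == 3) || (p == 2 && q == 1) || (p == 2 && q == 3))
    (lab : Bool → Bool → Bool → ℕ) (hlab : lab = fun own p q => if own then (if p && q then 0 else 1) else (if !p && !q then 3 else 2)) :
    ∀ x0 p0 x1 p1 x2 p2 : Bool, (p1 = true → p0 = true) → (p2 = true → p1 = true) →
      leL (lab x0 p0 true) (lab x1 p1 false) = true → leL (lab x1 p1 true) (lab x2 p2 false) = true →
      leL (lab x0 p0 true) (lab x2 p2 false) = true := by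
  subst hleL; subst hlab; decide

/-- Raising the colour of the subdivided atom from red to blue moves the label of a max above it upward in `Λ`. [this work] -/
theorem lab_atom_mono
    (leL : ℕ → ℕ → Bool)
    (hleL : leL = fun p q => p == q || (p == 0 && q == 1) || (p == 0 && q == 3) || (p == 2 && q == 1) || (p == 2 && q == 3))
    (lab : Bool → Bool → Bool → ℕ) (hlab : lab = fun own p q => if own then (if p && q then 0 else 1) else (if !p && !q then 3 else 2)) :
    ∀ x p c : Bool, leL (lab x p true) (lab x p c) = true ∧ leL (lab x p c) (lab x p false) = true ∧ lab x p c < 4 := by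
  subst hleL; subst hlab; decide

/-- The label of the new maximal element `y` of the block `a < y > a'` (colours `cy, ca, cb`, `true` = red): the block moves allowed by `Λ`.
`0 = RI` only for the all-red block, `3 = BI` only for the all-blue block. [this work] -/
theorem block_facts
    (leL : ℕ → ℕ → Bool)
    (hleL : leL = fun p q => p == q || (p == 0 && q == 1) || (p == 0 && q == 3) || (p == 2 && q == 1) || (p == 2 && q == 3))
    (lab : Bool → Bool → Bool → ℕ) (hlab : lab = fun own p q => if own then (if p && q then 0 else 1) else (if !p && !q then 3 else 2)) :
    ∀ cy ca cb : Bool, lab cy ca cb < 4 ∧ (lab cy ca cb = 0 ↔ (cy = true ∧ ca = true ∧ cb = true)) ∧ (lab cy ca cb = 3 ↔ (cy = false ∧ ca = false ∧ cb = false)) ∧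
      (∀ cy' ca' cb' : Bool, leL (lab cy ca cb) (lab cy' ca' cb') = true → lab cy ca cb = 1 → lab cy' ca' cb' = 1) ∧
      (∀ cy' ca' cb' : Bool, leL (lab cy ca cb) (lab cy' ca' cb') = true → lab cy ca cb = 3 → lab cy' ca' cb' = 3) ∧
      (∀ cy' ca' cb' : Bool, leL (lab cy ca cb) (lab cy' ca' cb') = true → lab cy ca cb = 2 → lab cy' ca' cb' ≠ 0) ∧
      (∀ cy' ca' cb' : Bool, leL (lab cy ca cb) (lab cy' ca' cb') = true → lab cy ca cb = 0 → lab cy' ca' cb' ≠ 2) := by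
  subst hleL; subst hlab; decide

variable {R : Type*} [Fintype R] [DecidableEq R]

/-- **INFLATION LEMMA (abstract form).**  Setting (hypothesis style): `R` = colourings of the rest; `xu, pu` (`xw, pw`) = colours (`true` = red) of the
maximal element `u` (`w`) above the subdivided atom and of its other atom, as functions of the rest; `restle` = the labelwise order on all other
coordinates (a preorder along which `pu, pw` can only turn blue); `ir` = complementation on rests.  Old colourings `R × Bool` (colour of the atom `a`) with
order `le1`; new colourings `R × (Bool × Bool × Bool)` (colours of `a, y, a'`, `y` the new maximal element over `a, a'`, `u > a`, `w > a'`) with order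
`le2`; involutions `ι₁, ι₂` = complement everything.  CLAIM: for all up-sets `A', B'` of the old colouring poset there are up-sets `A, B` of the new one
with the same antipodal defect `#(A ∩ B) − #(A ∩ ι B)`, and `A` is a half if `A'` is.  (PROOF-INFLATION-g47.md §1–§4: `A = {y = RN} ∪ {y = RI, σ^r ∈ A'} ∪
{y = BI, σ^b ∈ A'}`, `B = {y = RI, σ^r ∈ B'} ∪ {y = BI, σ^b ∈ B'} ∪ {y ∈ {RN,BN}, σ ∈ Cl(B'_r)}`, `Cl` = closure under the transitive cross relation
`σ ◁ σ' :⟺ σ^r ≤ σ'^b`.)  Instantiated with `R` = colourings of `C_{2(k-1)} ∖ {a_1}` this is the induction step of THEOREM C∞ (Ω(C_2k) not AK ∀ k ≥ 3).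
[this work] -/
theorem inflation
    (leL : ℕ → ℕ → Bool)
    (hleL : leL = fun p q => p == q || (p == 0 && q == 1) || (p == 0 && q == 3) || (p == 2 && q == 1) || (p == 2 && q == 3))
    (lab : Bool → Bool → Bool → ℕ) (hlab : lab = fun own p q => if own then (if p && q then 0 else 1) else (if !p && !q then 3 else 2))
    (restle : R → R → Prop) (htrans : ∀ σ₁ σ₂ σ₃, restle σ₁ σ₂ → restle σ₂ σ₃ → restle σ₁ σ₃)
    (xu pu xw pw : R → Bool) (hpu : ∀ σ σ', restle σ σ' → pu σ' = true → pu σ = true) (hpw : ∀ σ σ', restle σ σ' → pw σ' = true → pw σ = true)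
    (ir : R → R) (hir : ∀ σ, ir (ir σ) = σ)
    (le1 : R × Bool → R × Bool → Prop)
    (hle1 : ∀ σ σ' c c', le1 (σ, c) (σ', c') ↔ restle σ σ' ∧ (c' = true → c = true) ∧
      leL (lab (xu σ) (pu σ) c) (lab (xu σ') (pu σ') c') = true ∧ leL (lab (xw σ) (pw σ) c) (lab (xw σ') (pw σ') c') = true)
    (le2 : R × (Bool × Bool × Bool) → R × (Bool × Bool × Bool) → Prop)
    (hle2 : ∀ σ σ' ca cy cb ca' cy' cb', le2 (σ, (ca, cy, cb)) (σ', (ca', cy', cb')) ↔ restle σ σ' ∧ (ca' = true → ca = true) ∧ (cb' = true → cb = true) ∧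
      leL (lab (xu σ) (pu σ) ca) (lab (xu σ') (pu σ') ca') = true ∧ leL (lab (xw σ) (pw σ) cb) (lab (xw σ') (pw σ') cb') = true ∧
      leL (lab cy ca cb) (lab cy' ca' cb') = true)
    (ι₁ : R × Bool → R × Bool) (hι₁ : ∀ σ c, ι₁ (σ, c) = (ir σ, !c))
    (ι₂ : R × (Bool × Bool × Bool) → R × (Bool × Bool × Bool)) (hι₂ : ∀ σ ca cy cb, ι₂ (σ, (ca, cy, cb)) = (ir σ, (!ca, !cy, !cb)))
    (A' B' : Finset (R × Bool))
    (hA' : ∀ p q, le1 p q → p ∈ A' → q ∈ A') (hB' : ∀ p q, le1 p q → p ∈ B' → q ∈ B') :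
    ∃ A B : Finset (R × (Bool × Bool × Bool)),
      (∀ p q, le2 p q → p ∈ A → q ∈ A) ∧ (∀ p q, le2 p q → p ∈ B → q ∈ B) ∧
      ((A ∩ B).card : ℤ) - ((A ∩ B.image ι₂).card : ℤ) = ((A' ∩ B').card : ℤ) - ((A' ∩ B'.image ι₁).card : ℤ) ∧
      (A'.card = Fintype.card R → A.card = 4 * Fintype.card R) := by
  classical
  have hlab4 := lab_atom_mono leL hleL lab hlab
  have hblk := block_facts leL hleL lab hlab
  have hcore := cross_trans_core leL hleL lab hlab
  -- the label of the new max y for a block β = (ca, cy, cb)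
  set v : Bool × Bool × Bool → ℕ := fun β => lab β.2.1 β.1 β.2.2 with hv
  have hvdef : ∀ ca cy cb, v (ca, cy, cb) = lab cy ca cb := fun _ _ _ => rfl
  -- the cross relation and its closure applied to B'_r
  set cross : R → R → Prop := fun σ σ' => le1 (σ, true) (σ', false) with hcross
  have cross_trans : ∀ σ₀ σ₁ σ₂, cross σ₀ σ₁ → cross σ₁ σ₂ → cross σ₀ σ₂ := by
    intro σ₀ σ₁ σ₂ h1 h2
    simp only [hcross, hle1] at h1 h2 ⊢
    obtain ⟨r1, -, u1, w1⟩ := h1; obtain ⟨r2, -, u2, w2⟩ := h2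
    refine ⟨htrans _ _ _ r1 r2, fun h => Bool.noConfusion h, ?_, ?_⟩
    · exact hcore _ _ _ _ _ _ (hpu _ _ r1) (hpu _ _ r2) u1 u2
    · exact hcore _ _ _ _ _ _ (hpw _ _ r1) (hpw _ _ r2) w1 w2
  set G : Finset R := Finset.univ.filter (fun σ' => ∃ σ, (σ, true) ∈ B' ∧ cross σ σ') with hG
  have hGmem : ∀ σ', σ' ∈ G ↔ ∃ σ, (σ, true) ∈ B' ∧ cross σ σ' := by intro σ'; simp [hG]
  -- (F2): every comparable pair of new colourings gives a cross pair of rests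
  have F2 : ∀ σ σ' β β', le2 (σ, β) (σ', β') → cross σ σ' := by
    rintro σ σ' ⟨ca, cy, cb⟩ ⟨ca', cy', cb'⟩ h
    rw [hle2] at h; obtain ⟨hr, -, -, hu, hw, -⟩ := h
    simp only [hcross, hle1]
    refine ⟨hr, fun h => Bool.noConfusion h, ?_, ?_⟩
    · have a1 := (hlab4 (xu σ) (pu σ) ca).1; have a2 := (hlab4 (xu σ') (pu σ') ca').2.1
      exact AntitheticCrownBridge.leL_trans leL hleL (hlab4 _ _ _).2.2 (hlab4 _ _ _).2.2 (hlab4 _ _ _).2.2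
        (AntitheticCrownBridge.leL_trans leL hleL (hlab4 _ _ _).2.2 (hlab4 _ _ _).2.2 (hlab4 _ _ _).2.2 a1 hu) a2
    · have a1 := (hlab4 (xw σ) (pw σ) cb).1; have a2 := (hlab4 (xw σ') (pw σ') cb').2.1
      exact AntitheticCrownBridge.leL_trans leL hleL (hlab4 _ _ _).2.2 (hlab4 _ _ _).2.2 (hlab4 _ _ _).2.2
        (AntitheticCrownBridge.leL_trans leL hleL (hlab4 _ _ _).2.2 (hlab4 _ _ _).2.2 (hlab4 _ _ _).2.2 a1 hw) a2
  -- (F1): monochromatic blocks compare like old colourings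
  have F1 : ∀ σ σ' (c c' : Bool), le2 (σ, (c, c, c)) (σ', (c', c', c')) → le1 (σ, c) (σ', c') := by
    intro σ σ' c c' h
    rw [hle2] at h; obtain ⟨hr, hca, -, hu, hw, -⟩ := h
    rw [hle1]; exact ⟨hr, hca, hu, hw⟩
  -- the two sets
  set A : Finset (R × (Bool × Bool × Bool)) := Finset.univ.filter (fun p => v p.2 = 1 ∨ (v p.2 = 0 ∧ (p.1, true) ∈ A') ∨ (v p.2 = 3 ∧ (p.1, false) ∈ A'))
    with hA
  set B : Finset (R × (Bool × Bool × Bool)) := Finset.univ.filter (fun p => (v p.2 = 0 ∧ (p.1, true) ∈ B') ∨ (v p.2 = 3 ∧ (p.1, false) ∈ B') ∨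
    ((v p.2 = 1 ∨ v p.2 = 2) ∧ p.1 ∈ G)) with hB
  have hAmem : ∀ σ β, (σ, β) ∈ A ↔ v β = 1 ∨ (v β = 0 ∧ (σ, true) ∈ A') ∨ (v β = 3 ∧ (σ, false) ∈ A') := by intro σ β; simp [hA]
  have hBmem : ∀ σ β, (σ, β) ∈ B ↔ (v β = 0 ∧ (σ, true) ∈ B') ∨ (v β = 3 ∧ (σ, false) ∈ B') ∨ ((v β = 1 ∨ v β = 2) ∧ σ ∈ G) := by intro σ β; simp [hB]
  -- block moves along le2
  have hvle : ∀ σ σ' β β', le2 (σ, β) (σ', β') → leL (v β) (v β') = true := by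
    rintro σ σ' ⟨ca, cy, cb⟩ ⟨ca', cy', cb'⟩ h; rw [hle2] at h; exact h.2.2.2.2.2
  have hv0 : ∀ β : Bool × Bool × Bool, v β = 0 ↔ β = (true, true, true) := by
    rintro ⟨ca, cy, cb⟩; rw [hvdef, (hblk cy ca cb).2.1]; simp [Prod.ext_iff]; tauto
  have hv3 : ∀ β : Bool × Bool × Bool, v β = 3 ↔ β = (false, false, false) := by
    rintro ⟨ca, cy, cb⟩; rw [hvdef, (hblk cy ca cb).2.2.1]; simp [Prod.ext_iff]; tauto
  have mv1 : ∀ β β' : Bool × Bool × Bool, leL (v β) (v β') = true → v β = 1 → v β' = 1 := by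
    rintro ⟨ca, cy, cb⟩ ⟨ca', cy', cb'⟩; exact (hblk cy ca cb).2.2.2.1 cy' ca' cb'
  have mv3 : ∀ β β' : Bool × Bool × Bool, leL (v β) (v β') = true → v β = 3 → v β' = 3 := by
    rintro ⟨ca, cy, cb⟩ ⟨ca', cy', cb'⟩; exact (hblk cy ca cb).2.2.2.2.1 cy' ca' cb'
  have mv2 : ∀ β β' : Bool × Bool × Bool, leL (v β) (v β') = true → v β = 2 → v β' ≠ 0 := by
    rintro ⟨ca, cy, cb⟩ ⟨ca', cy', cb'⟩; exact (hblk cy ca cb).2.2.2.2.2.1 cy' ca' cb'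
  have mv0 : ∀ β β' : Bool × Bool × Bool, leL (v β) (v β') = true → v β = 0 → v β' ≠ 2 := by
    rintro ⟨ca, cy, cb⟩ ⟨ca', cy', cb'⟩; exact (hblk cy ca cb).2.2.2.2.2.2 cy' ca' cb'
  have vlt : ∀ β : Bool × Bool × Bool, v β < 4 := by rintro ⟨ca, cy, cb⟩; exact (hblk cy ca cb).1
  have vcases : ∀ β : Bool × Bool × Bool, v β = 0 ∨ v β = 1 ∨ v β = 2 ∨ v β = 3 := by intro β; have := vlt β; omega
  refine ⟨A, B, ?_, ?_, ?_, ?_⟩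
  -- ### A is an up-set
  · rintro ⟨σ, β⟩ ⟨σ', β'⟩ hle hp
    rw [hAmem] at hp ⊢
    have hvv := hvle _ _ _ _ hle
    rcases hp with h1 | ⟨h0, ha⟩ | ⟨h3, ha⟩
    · exact Or.inl (mv1 _ _ hvv h1)
    · rcases vcases β' with h' | h' | h' | h'
      · right; left; refine ⟨h', ?_⟩
        rw [(hv0 β).1 h0, (hv0 β').1 h'] at hle
        exact hA' _ _ (F1 _ _ _ _ hle) ha
      · exact Or.inl h'
      · exact ((mv0 _ _ hvv h0) h').elim
      · right; right; refine ⟨h', ?_⟩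
        rw [(hv0 β).1 h0, (hv3 β').1 h'] at hle
        exact hA' _ _ (F1 _ _ _ _ hle) ha
    · right; right
      have h' := mv3 _ _ hvv h3
      refine ⟨h', ?_⟩
      rw [(hv3 β).1 h3, (hv3 β').1 h'] at hle
      exact hA' _ _ (F1 _ _ _ _ hle) ha
  -- ### B is an up-set
  · rintro ⟨σ, β⟩ ⟨σ', β'⟩ hle hp
    rw [hBmem] at hp ⊢
    have hvv := hvle _ _ _ _ hle
    have hx := F2 _ _ _ _ hle
    rcases hp with ⟨h0, hb⟩ | ⟨h3, hb⟩ | ⟨h12, hg⟩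
    · rcases vcases β' with h' | h' | h' | h'
      · left; refine ⟨h', ?_⟩
        rw [(hv0 β).1 h0, (hv0 β').1 h'] at hle
        exact hB' _ _ (F1 _ _ _ _ hle) hb
      · right; right; exact ⟨Or.inl h', (hGmem σ').2 ⟨σ, hb, hx⟩⟩
      · exact ((mv0 _ _ hvv h0) h').elim
      · right; left; refine ⟨h', ?_⟩
        rw [(hv0 β).1 h0, (hv3 β').1 h'] at hle
        exact hB' _ _ (F1 _ _ _ _ hle) hb
    · right; left
      have h' := mv3 _ _ hvv h3
      refine ⟨h', ?_⟩
      rw [(hv3 β).1 h3, (hv3 β').1 h'] at hle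
      exact hB' _ _ (F1 _ _ _ _ hle) hb
    · obtain ⟨σ₀, hb0, hx0⟩ := (hGmem σ).1 hg
      have hx2 : cross σ₀ σ' := cross_trans _ _ _ hx0 hx
      rcases vcases β' with h' | h' | h' | h'
      · exfalso
        rcases h12 with h1 | h2
        · have := mv1 _ _ hvv h1; omega
        · exact (mv2 _ _ hvv h2) h'
      · right; right; exact ⟨Or.inl h', (hGmem σ').2 ⟨σ₀, hb0, hx2⟩⟩
      · right; right; exact ⟨Or.inr h', (hGmem σ').2 ⟨σ₀, hb0, hx2⟩⟩
      · right; left; refine ⟨h', ?_⟩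
        exact hB' _ _ hx2 hb0
  -- ### the count
  · -- pieces
    set RN3 : Finset (Bool × Bool × Bool) := {(false, true, true), (true, true, false), (false, true, false)} with hRN3
    set Srr : Finset R := Finset.univ.filter (fun σ => (σ, true) ∈ A' ∧ (σ, true) ∈ B') with hSrr
    set Sbb : Finset R := Finset.univ.filter (fun σ => (σ, false) ∈ A' ∧ (σ, false) ∈ B') with hSbb
    set Trr : Finset R := Finset.univ.filter (fun σ => (σ, true) ∈ A' ∧ (ir σ, false) ∈ B') with hTrr
    set Tbb : Finset R := Finset.univ.filter (fun σ => (σ, false) ∈ A' ∧ (ir σ, true) ∈ B') with hTbb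
    set Gi : Finset R := Finset.univ.filter (fun σ => ir σ ∈ G) with hGi
    have hι₂inv : ∀ p, ι₂ (ι₂ p) = p := by rintro ⟨σ, ca, cy, cb⟩; rw [hι₂, hι₂, hir]; simp
    have hι₁inv : ∀ p, ι₁ (ι₁ p) = p := by rintro ⟨σ, c⟩; rw [hι₁, hι₁, hir]; simp
    have memι₂ : ∀ p, p ∈ B.image ι₂ ↔ ι₂ p ∈ B := by
      intro p; constructor
      · intro h; obtain ⟨q, hq, rfl⟩ := Finset.mem_image.1 h; rw [hι₂inv]; exact hq
      · intro h; exact Finset.mem_image.2 ⟨ι₂ p, h, hι₂inv p⟩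
    have memι₁ : ∀ p, p ∈ B'.image ι₁ ↔ ι₁ p ∈ B' := by
      intro p; constructor
      · intro h; obtain ⟨q, hq, rfl⟩ := Finset.mem_image.1 h; rw [hι₁inv]; exact hq
      · intro h; exact Finset.mem_image.2 ⟨ι₁ p, h, hι₁inv p⟩
    have vvals : ∀ ca cy cb : Bool, v (ca, cy, cb) = lab cy ca cb := fun _ _ _ => rfl
    have E1 : A ∩ B = (G ×ˢ RN3) ∪ (Srr ×ˢ {(true, true, true)}) ∪ (Sbb ×ˢ {(false, false, false)}) := by
      ext ⟨σ, ca, cy, cb⟩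
      simp only [Finset.mem_inter, hAmem, hBmem, Finset.mem_union, Finset.mem_product, hRN3, hSrr, hSbb, Finset.mem_filter, Finset.mem_univ, true_and,
        Finset.mem_insert, Finset.mem_singleton, vvals, hlab]
      cases ca <;> cases cy <;> cases cb <;> simp
    have E2 : A ∩ B.image ι₂ = (Gi ×ˢ RN3) ∪ (Trr ×ˢ {(true, true, true)}) ∪ (Tbb ×ˢ {(false, false, false)}) := by
      ext ⟨σ, ca, cy, cb⟩
      rw [Finset.mem_inter, memι₂, hι₂]
      simp only [hAmem, hBmem, Finset.mem_union, Finset.mem_product, hRN3, hTrr, hTbb, hGi, Finset.mem_filter, Finset.mem_univ, true_and,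
        Finset.mem_insert, Finset.mem_singleton, vvals, hlab]
      cases ca <;> cases cy <;> cases cb <;> simp
    have E3 : A' ∩ B' = (Srr ×ˢ {true}) ∪ (Sbb ×ˢ {false}) := by
      ext ⟨σ, c⟩
      simp only [Finset.mem_inter, Finset.mem_union, Finset.mem_product, hSrr, hSbb, Finset.mem_filter, Finset.mem_univ, true_and, Finset.mem_singleton]
      cases c <;> simp
    have E4 : A' ∩ B'.image ι₁ = (Trr ×ˢ {true}) ∪ (Tbb ×ˢ {false}) := by
      ext ⟨σ, c⟩
      rw [Finset.mem_inter, memι₁, hι₁]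
      simp only [Finset.mem_union, Finset.mem_product, hTrr, hTbb, Finset.mem_filter, Finset.mem_univ, true_and, Finset.mem_singleton]
      cases c <;> simp
    have hGi_card : Gi.card = G.card := by
      have : Gi = G.image ir := by
        ext σ; simp only [hGi, Finset.mem_filter, Finset.mem_univ, true_and, Finset.mem_image]
        constructor
        · intro h; exact ⟨ir σ, h, hir σ⟩
        · rintro ⟨τ, hτ, rfl⟩; rw [hir]; exact hτ
      rw [this]; exact Finset.card_image_of_injective _ (fun x y h => by simpa [hir] using congrArg ir h)
    have cRN3 : RN3.card = 3 := by rw [hRN3]; decide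
    have d1 : Disjoint (G ×ˢ RN3) (Srr ×ˢ ({(true, true, true)} : Finset (Bool × Bool × Bool))) := by
      rw [Finset.disjoint_left]; rintro ⟨σ, β⟩ h1 h2
      rw [Finset.mem_product] at h1 h2; rw [Finset.mem_singleton] at h2; rw [h2.2, hRN3] at h1; simp at h1
    have d2 : Disjoint (G ×ˢ RN3 ∪ Srr ×ˢ ({(true, true, true)} : Finset (Bool × Bool × Bool))) (Sbb ×ˢ ({(false, false, false)} : Finset _)) := by
      rw [Finset.disjoint_left]; rintro ⟨σ, β⟩ h1 h2
      rw [Finset.mem_product, Finset.mem_singleton] at h2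
      rw [Finset.mem_union, Finset.mem_product, Finset.mem_product, Finset.mem_singleton, h2.2, hRN3] at h1; simp at h1
    have d1' : Disjoint (Gi ×ˢ RN3) (Trr ×ˢ ({(true, true, true)} : Finset (Bool × Bool × Bool))) := by
      rw [Finset.disjoint_left]; rintro ⟨σ, β⟩ h1 h2
      rw [Finset.mem_product] at h1 h2; rw [Finset.mem_singleton] at h2; rw [h2.2, hRN3] at h1; simp at h1
    have d2' : Disjoint (Gi ×ˢ RN3 ∪ Trr ×ˢ ({(true, true, true)} : Finset (Bool × Bool × Bool))) (Tbb ×ˢ ({(false, false, false)} : Finset _)) := by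
      rw [Finset.disjoint_left]; rintro ⟨σ, β⟩ h1 h2
      rw [Finset.mem_product, Finset.mem_singleton] at h2
      rw [Finset.mem_union, Finset.mem_product, Finset.mem_product, Finset.mem_singleton, h2.2, hRN3] at h1; simp at h1
    have d3 : Disjoint (Srr ×ˢ ({true} : Finset Bool)) (Sbb ×ˢ ({false} : Finset Bool)) := by
      rw [Finset.disjoint_left]; rintro ⟨σ, c⟩ h1 h2
      rw [Finset.mem_product, Finset.mem_singleton] at h1 h2; rw [h1.2] at h2; exact Bool.noConfusion h2.2
    have d3' : Disjoint (Trr ×ˢ ({true} : Finset Bool)) (Tbb ×ˢ ({false} : Finset Bool)) := by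
      rw [Finset.disjoint_left]; rintro ⟨σ, c⟩ h1 h2
      rw [Finset.mem_product, Finset.mem_singleton] at h1 h2; rw [h1.2] at h2; exact Bool.noConfusion h2.2
    rw [E1, E2, E3, E4, Finset.card_union_of_disjoint d2, Finset.card_union_of_disjoint d1, Finset.card_union_of_disjoint d2',
      Finset.card_union_of_disjoint d1', Finset.card_union_of_disjoint d3, Finset.card_union_of_disjoint d3']
    simp only [Finset.card_product, Finset.card_singleton, hGi_card, cRN3]
    push_cast; ring
  -- ### halves go to halves
  · intro hhalf
    set Ar : Finset R := Finset.univ.filter (fun σ => (σ, true) ∈ A') with hAr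
    set Ab : Finset R := Finset.univ.filter (fun σ => (σ, false) ∈ A') with hAb
    have vvals : ∀ ca cy cb : Bool, v (ca, cy, cb) = lab cy ca cb := fun _ _ _ => rfl
    set RN3 : Finset (Bool × Bool × Bool) := {(false, true, true), (true, true, false), (false, true, false)} with hRN3
    have EA : A = (Finset.univ ×ˢ RN3) ∪ (Ar ×ˢ {(true, true, true)}) ∪ (Ab ×ˢ {(false, false, false)}) := by
      ext ⟨σ, ca, cy, cb⟩
      simp only [hAmem, Finset.mem_union, Finset.mem_product, hRN3, hAr, hAb, Finset.mem_filter, Finset.mem_univ, true_and,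
        Finset.mem_insert, Finset.mem_singleton, vvals, hlab]
      cases ca <;> cases cy <;> cases cb <;> simp
    have EA' : A' = (Ar ×ˢ {true}) ∪ (Ab ×ˢ {false}) := by
      ext ⟨σ, c⟩
      simp only [Finset.mem_union, Finset.mem_product, hAr, hAb, Finset.mem_filter, Finset.mem_univ, true_and, Finset.mem_singleton]
      cases c <;> simp
    have d1 : Disjoint (Finset.univ ×ˢ RN3) (Ar ×ˢ ({(true, true, true)} : Finset (Bool × Bool × Bool))) := by
      rw [Finset.disjoint_left]; rintro ⟨σ, β⟩ h1 h2
      rw [Finset.mem_product] at h1 h2; rw [Finset.mem_singleton] at h2; rw [h2.2, hRN3] at h1; simp at h1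
    have d2 : Disjoint (Finset.univ ×ˢ RN3 ∪ Ar ×ˢ ({(true, true, true)} : Finset (Bool × Bool × Bool))) (Ab ×ˢ ({(false, false, false)} : Finset _)) := by
      rw [Finset.disjoint_left]; rintro ⟨σ, β⟩ h1 h2
      rw [Finset.mem_product, Finset.mem_singleton] at h2
      rw [Finset.mem_union, Finset.mem_product, Finset.mem_product, Finset.mem_singleton, h2.2, hRN3] at h1; simp at h1
    have d3 : Disjoint (Ar ×ˢ ({true} : Finset Bool)) (Ab ×ˢ ({false} : Finset Bool)) := by
      rw [Finset.disjoint_left]; rintro ⟨σ, c⟩ h1 h2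
      rw [Finset.mem_product, Finset.mem_singleton] at h1 h2; rw [h1.2] at h2; exact Bool.noConfusion h2.2
    have cA' : A'.card = Ar.card + Ab.card := by
      rw [EA', Finset.card_union_of_disjoint d3]; simp
    have cRN3 : RN3.card = 3 := by rw [hRN3]; decide
    rw [EA, Finset.card_union_of_disjoint d2, Finset.card_union_of_disjoint d1]
    simp only [Finset.card_product, Finset.card_singleton, Finset.card_univ, cRN3]
    rw [cA'] at hhalf; omega

end AntitheticInflation

end Summit.CriticalPhenomena.PercolationContinuityZ3.Theorems
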